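import Mathlib
import HarnessLib.Audit
import Summits.PneNP.PneNP.Theorems.PstarAdditiveSplit

/-!
# Splitting the readers of a core along a variable set with a switch literal — the calculus (ROUND-24, O1; memo g25 §41–§42)

FRONTIER range-avoidance ladder, rung F-N3, ROUND 24 (cell `pnp-ideate`, prover-2 memo `g25/O1-XORSPLIT-g25.md` §41–§42; typed targets
`PstarCoreBoundTargets.TerminalFive` / `TerminalPeelable` (p646951); restricted-model proof complexity — nothing here bears on `P` versus `NP`).

Tools for `PstarSwitchSplit` (an XOR-disconnected terminal core coupled through one switch literal has a terminal side):
* `gin` / `gout` / `litSet` — the monomials of a reader inside / outside a variable set `P`, and the GATED LITERALS of `P` (the `P`-endpoints of an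
  odd number of monomials straddling `P`);
* `gval_split_switch` — when every straddling monomial is a gate to ONE switch variable `q ∉ P`:
  `gval C G z = gval C|P G|P z ⊕ gval C|Pᶜ G|Pᶜ z ⊕ z_q · parity(litSet) z`;
* `gval_class`, `gval_out_switch` — the class readers `C|P ∆ κ·litSet` and `C|Pᶜ ∆ δ·{q}` as G-constraints;
* `xorClosed_side` — a side of a variable split of an XOR-closed family is XOR-closed;
* closed Boolean bookkeeping lemmas (`bool_*`), each a `decide`.
-/

set_option linter.dupNamespace false -- `Summit.PneNP.PneNP.…`: summit = sub-problem name (D-0017 single-conjunct layout)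

open Finset Literature.Computability.Complexity
open scoped symmDiff
open Summit.PneNP.PneNP.Theorems.PstarFibrePolys (bit bit_injective bit_xor bit_and)
open Summit.PneNP.PneNP.Theorems.PstarPDT (parity parity_singleton)
open Summit.PneNP.PneNP.Theorems.PstarGraphQuadGapOne (bit_parity)
open Summit.PneNP.PneNP.Theorems.PstarSALevel (varSet bdry)
open Summit.PneNP.PneNP.Theorems.PstarSAClosure (degIn mem_bdry_iff)
open Summit.PneNP.PneNP.Theorems.PstarGapOneAll (gval gval_empty)
open Summit.PneNP.PneNP.Theorems.PstarGConstraint (bit_gval)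
open Summit.PneNP.PneNP.Theorems.PstarGSystemFreeVar (gval_symmDiff)
open Summit.PneNP.PneNP.Theorems.PstarCoreBound (XorClosed)

namespace Summit.PneNP.PneNP.Theorems.PstarSwitchSplitTools

variable {n m : ℕ}

/-! ## Splitting a reader along `P` with a switch literal `q` -/

/-- The monomials of `G` with both AND variables in `P`. -/
def gin (I : LocalMap 4 n m) (P : Finset (Fin n)) (G : Finset (Fin m)) : Finset (Fin m) :=
  G.filter fun g => I.vars g 2 ∈ P ∧ I.vars g 3 ∈ P

/-- The monomials of `G` with both AND variables outside `P`. -/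
def gout (I : LocalMap 4 n m) (P : Finset (Fin n)) (G : Finset (Fin m)) : Finset (Fin m) :=
  G.filter fun g => I.vars g 2 ∉ P ∧ I.vars g 3 ∉ P

/-- The GATED LITERALS of `G` along `P`: the variables of `P` that are the `P`-endpoint of an odd number of monomials of `G` straddling `P`. -/
def litSet (I : LocalMap 4 n m) (P : Finset (Fin n)) (G : Finset (Fin m)) : Finset (Fin n) :=
  P.filter fun p => Odd ((G.filter fun g => ¬ (I.vars g 2 ∈ P ↔ I.vars g 3 ∈ P) ∧
    (if I.vars g 2 ∈ P then I.vars g 2 else I.vars g 3) = p).card)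

/-- `gin G ⊆ G`. -/
theorem gin_subset (I : LocalMap 4 n m) (P : Finset (Fin n)) (G : Finset (Fin m)) : gin I P G ⊆ G := filter_subset _ _

/-- `gout G ⊆ G`. -/
theorem gout_subset (I : LocalMap 4 n m) (P : Finset (Fin n)) (G : Finset (Fin m)) : gout I P G ⊆ G := filter_subset _ _

/-- `litSet ⊆ P`. -/
theorem litSet_subset (I : LocalMap 4 n m) (P : Finset (Fin n)) (G : Finset (Fin m)) : litSet I P G ⊆ P := filter_subset _ _

/-- **Splitting a reader along `P` when every straddling monomial is a gate to the switch `q ∉ P`:**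
`gval C G z = gval C|P G|P z ⊕ gval C|Pᶜ G|Pᶜ z ⊕ z_q · parity(litSet) z`. -/
theorem gval_split_switch (I : LocalMap 4 n m) (P : Finset (Fin n)) {q : Fin n} (hq : q ∉ P) (C : Finset (Fin n)) {G : Finset (Fin m)}
    (hsw : ∀ g ∈ G, (I.vars g 2 ∈ P ↔ I.vars g 3 ∈ P) ∨ (I.vars g 2 ∈ P ∧ I.vars g 3 = q) ∨ (I.vars g 3 ∈ P ∧ I.vars g 2 = q))
    (z : Fin n → Bool) :
    gval I C G z = xor (xor (gval I (C.filter (· ∈ P)) (gin I P G) z) (gval I (C.filter (· ∉ P)) (gout I P G) z))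
      (z q && parity (litSet I P G) z) := by
  classical
  apply bit_injective
  -- the three-way partition of the monomials
  set str := G.filter fun g => ¬ (I.vars g 2 ∈ P ↔ I.vars g 3 ∈ P) with hstr
  set pv : Fin m → Fin n := fun g => if I.vars g 2 ∈ P then I.vars g 2 else I.vars g 3 with hpv
  have hGsplit : ∑ g ∈ G, bit (z (I.vars g 2)) * bit (z (I.vars g 3)) =
      ∑ g ∈ gin I P G, bit (z (I.vars g 2)) * bit (z (I.vars g 3)) +
        (∑ g ∈ gout I P G, bit (z (I.vars g 2)) * bit (z (I.vars g 3)) + ∑ g ∈ str, bit (z (I.vars g 2)) * bit (z (I.vars g 3))) := by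
    rw [← sum_filter_add_sum_filter_not G (fun g => I.vars g 2 ∈ P ∧ I.vars g 3 ∈ P)]
    unfold gin
    congr 1
    rw [← sum_filter_add_sum_filter_not (G.filter fun g => ¬ (I.vars g 2 ∈ P ∧ I.vars g 3 ∈ P)) (fun g => I.vars g 2 ∉ P ∧ I.vars g 3 ∉ P)]
    rw [filter_filter, filter_filter]
    unfold gout
    congr 1
    · exact sum_congr (filter_congr fun g _ => by tauto) fun _ _ => rfl
    · rw [hstr]
      exact sum_congr (filter_congr fun g _ => by tauto) fun _ _ => rfl
  -- a straddling monomial is `z_{pv g} · z_q`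
  have hstrP : ∀ g ∈ str, pv g ∈ P := by
    intro g hg
    obtain ⟨-, hne⟩ := mem_filter.1 hg
    change (if I.vars g 2 ∈ P then I.vars g 2 else I.vars g 3) ∈ P
    by_cases h2 : I.vars g 2 ∈ P
    · rw [if_pos h2]; exact h2
    · rw [if_neg h2]; by_contra h3; exact hne ⟨fun h => absurd h h2, fun h => absurd h h3⟩
  have hprod : ∀ g ∈ str, bit (z (I.vars g 2)) * bit (z (I.vars g 3)) = bit (z (pv g)) * bit (z q) := by
    intro g hg
    obtain ⟨hgG, hne⟩ := mem_filter.1 hg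
    change _ = bit (z (if I.vars g 2 ∈ P then I.vars g 2 else I.vars g 3)) * bit (z q)
    rcases hsw g hgG with h | ⟨h2, h3⟩ | ⟨h3, h2⟩
    · exact absurd h hne
    · rw [if_pos h2, h3]
    · rw [if_neg (fun h => hq (h2 ▸ h)), h2, mul_comm]
  have hstrSum : ∑ g ∈ str, bit (z (I.vars g 2)) * bit (z (I.vars g 3)) = bit (parity (litSet I P G) z) * bit (z q) := by
    rw [sum_congr rfl hprod, ← sum_mul, bit_parity]
    congr 1
    rw [← sum_fiberwise_of_maps_to' (s := str) (t := P) (g := pv) hstrP (fun p => bit (z p))]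
    unfold litSet
    rw [sum_filter]
    refine sum_congr rfl fun p _ => ?_
    rw [sum_const, nsmul_eq_mul]
    have hset : (str.filter fun g => pv g = p) = G.filter fun g => ¬ (I.vars g 2 ∈ P ↔ I.vars g 3 ∈ P) ∧
        (if I.vars g 2 ∈ P then I.vars g 2 else I.vars g 3) = p := by
      rw [hstr, filter_filter]
    rw [hset]
    by_cases ho : Odd ((G.filter fun g => ¬ (I.vars g 2 ∈ P ↔ I.vars g 3 ∈ P) ∧ (if I.vars g 2 ∈ P then I.vars g 2 else I.vars g 3) = p).card)
    · rw [if_pos ho, (ZMod.natCast_eq_one_iff_odd).2 ho, one_mul]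
    · rw [if_neg ho, (ZMod.natCast_eq_zero_iff_even).2 (Nat.not_odd_iff_even.1 ho), zero_mul]
  rw [bit_xor, bit_xor, bit_and, bit_gval, bit_gval, bit_gval, ← sum_filter_add_sum_filter_not C (· ∈ P), hGsplit, hstrSum]
  ring

/-- The class-`κ` reader on the `P`-side: `gval (C|P ∆ κ·litSet) G|P z = gval C|P G|P z ⊕ κ·parity(litSet) z`. -/
theorem gval_class (I : LocalMap 4 n m) (P C : Finset (Fin n)) (G : Finset (Fin m)) (κ : Bool) (z : Fin n → Bool) :
    gval I ((C.filter (· ∈ P)) ∆ (if κ then litSet I P G else ∅)) (gin I P G) z =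
      xor (gval I (C.filter (· ∈ P)) (gin I P G) z) (κ && parity (litSet I P G) z) := by
  have h := gval_symmDiff I (C.filter (· ∈ P)) (if κ then litSet I P G else ∅) (gin I P G) ∅ z
  have e : gin I P G ∆ (∅ : Finset (Fin m)) = gin I P G := symmDiff_bot _
  rw [e] at h
  rw [h, gval_empty]
  cases κ
  · rw [if_neg Bool.false_ne_true, Bool.false_and]
    unfold parity; simp
  · rw [if_pos rfl, Bool.true_and]

/-- The `Pᶜ`-side reader with the switch added linearly: `gval (C|Pᶜ ∆ δ·{q}) G|Pᶜ z = gval C|Pᶜ G|Pᶜ z ⊕ δ·z_q`. -/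
theorem gval_out_switch (I : LocalMap 4 n m) (P C : Finset (Fin n)) (G : Finset (Fin m)) (q : Fin n) (δ : Bool) (z : Fin n → Bool) :
    gval I ((C.filter (· ∉ P)) ∆ (if δ then ({q} : Finset (Fin n)) else ∅)) (gout I P G) z =
      xor (gval I (C.filter (· ∉ P)) (gout I P G) z) (δ && z q) := by
  have h := gval_symmDiff I (C.filter (· ∉ P)) (if δ then ({q} : Finset (Fin n)) else ∅) (gout I P G) ∅ z
  have e : gout I P G ∆ (∅ : Finset (Fin m)) = gout I P G := symmDiff_bot _
  rw [e] at h
  rw [h, gval_empty]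
  cases δ
  · rw [if_neg Bool.false_ne_true, Bool.false_and]
    unfold parity; simp
  · rw [if_pos rfl, Bool.true_and, parity_singleton]

/-! ## Closed Boolean bookkeeping -/

/-- `a ⊕ c = d = b ⊕ c ⟹ a = b`. -/
theorem bool_eq_of_xor_eq : ∀ a b c d : Bool, xor a c = d → xor b c = d → a = b := by decide

/-- From `¬(a = v₁ ∧ b = v₂)` and `a = v₁`: `b = ¬v₂`. -/
theorem bool_snd_of_nand : ∀ a b v₁ v₂ : Bool, ¬ (a = v₁ ∧ b = v₂) → a = v₁ → b = !v₂ := by decide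

/-- From `¬(a = v₁ ∧ b = v₂)` and `b = v₂`: `a = ¬v₁`. -/
theorem bool_fst_of_nand : ∀ a b v₁ v₂ : Bool, ¬ (a = v₁ ∧ b = v₂) → b = v₂ → a = !v₁ := by decide

/-- From `¬(a = v₁ ∧ b = v₂)` and `a ⊕ b = v₁ ⊕ v₂`: `(a, b) = (¬v₁, ¬v₂)`. -/
theorem bool_both_of_nand : ∀ a b v₁ v₂ : Bool, ¬ (a = v₁ ∧ b = v₂) → xor a b = xor v₁ v₂ → a = !v₁ ∧ b = !v₂ := by decide

/-- Solving `v ⊕ a = b` for `a`. -/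
theorem bool_solve_xor : ∀ v a b : Bool, xor v a = b → a = xor b v := by decide

/-- The switch identity: `e ⊕ (a ⊕ e)·¬k = a ⊕ (a ⊕ e)·k`. -/
theorem bool_switch_id : ∀ a e k : Bool, xor e ((xor a e) && !k) = xor a ((xor a e) && k) := by decide

/-- `a ≠ ¬t ⟹ a = t`. -/
theorem bool_eq_of_ne_not : ∀ a t : Bool, a ≠ !t → a = t := by decide

/-- `t ≠ ¬t`. -/
theorem bool_ne_not_self : ∀ t : Bool, t ≠ !t := by decide

/-- Cancelling `⊕ x`. -/
theorem bool_cancel_xor : ∀ a b x : Bool, xor a x = xor b x → a = b := by decide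

/-- The switch identity solved: `x ⊕ (a ⊕ e)·¬k = a ⊕ (a ⊕ e)·k ⟹ x = e`. -/
theorem bool_switch_cancel : ∀ a e x k : Bool, xor x ((xor a e) && !k) = xor a ((xor a e) && k) → x = e := by decide

/-- Re-associating a triple `⊕`. -/
theorem bool_xor_right_comm : ∀ a b c : Bool, xor (xor a b) c = xor (xor a c) b := by decide

/-- `a ≠ k ⟹ a = ¬k`. -/
theorem bool_eq_not_of_ne : ∀ a k : Bool, a ≠ k → a = !k := by decide

variable {I : LocalMap 4 n m} {K : Finset (Fin m)}

/-- A side of a variable split of an XOR-closed family is XOR-closed. -/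
theorem xorClosed_side (hX : XorClosed I K) {A B : Finset (Fin m)} (hAB : A ∪ B = K) (P : Finset (Fin n))
    (hAP : ∀ j ∈ A, ∀ s : Fin 4, I.vars j s ∈ P) (hBP : ∀ j ∈ B, ∀ s : Fin 4, I.vars j s ∉ P) : XorClosed I A := by
  classical
  intro f hf s hs hmem
  have hfK : f ∈ K := hAB ▸ mem_union_left B hf
  apply hX f hfK s hs
  rw [mem_bdry_iff] at hmem ⊢
  unfold PstarSAClosure.degIn at hmem ⊢
  rw [← hmem, ← hAB, filter_union]
  have hB0 : (B.filter fun j => I.vars f s ∈ varSet I j) = ∅ := by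
    refine filter_eq_empty_iff.2 fun j hj hv => ?_
    unfold PstarSALevel.varSet at hv
    obtain ⟨s', -, hs'⟩ := mem_image.1 hv
    exact hBP j hj s' (hs' ▸ hAP f hf s)
  rw [hB0, union_empty]

end Summit.PneNP.PneNP.Theorems.PstarSwitchSplitTools
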